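import Summits.QuantumFields.YangMills.Theorems.IR.LevelwiseDominationKernel
import Summits.QuantumFields.YangMills.Theorems.BalabanLadderIRcofTemporalTwistSubadditivity
import HarnessLib

/-!
# Line `flux-interlacing` for crux `IRcof` (stmt-QuantumFields-26930) — SUPPLIER ARROW #2

Thin skeleton form of lens-2 g1's card «flux-interlacing» (Ideas/flux-interlacing.md): for simply-connected
simple Lie groups, the confinement half of THE NUMBER follows from its neutral half — «no gapped deconfined
cold box».

STUBS (two):
* V = `stub_neutralPurityCof : NeutralPurityCof` — RESIDUAL (declared B2; pinned cofinal ε-purity of SOME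
  ⟨z⟩³ electric-flux projection; weaker BY NAME than ∀θ PXcof θ).
* I = `stub_fluxInterlacingEv : FluxInterlacingEv` — LEVER / SKEW / IDEA-NEEDED: for Lie groups at weak
  coupling, a cold box whose NEUTRAL sector is ε₀-pure is interlaced (charged trace ≤ κ × excited neutral
  trace); FALSE for finite G (frozen topological order), VACUOUS for U(1) (Coulomb phase).

The conversion V ∧ I ⇒ PXcof(1/24) is proved sorry-free in this file (`pinnedExitsCofinal_of_stubs`).
The full composition V ∧ I ∧ N_cof ⇒ IRcof is `IRcof_of` (the slot's `stub_irnscCof` is SHARED from the line of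
record `pinned_cofinal_bill`; any proof of V and I closes `stub_pinnedExitsCofinal` through the supplier arrow,
and IRcof follows through the line of record's sorry-free kernel `IRcof_of`).

Does NOT displace the line of record `pinned_cofinal_bill.lean` d3255819134117aa; this is SUPPLIER ARROW #2.

HONEST FRAMING: nothing here proves the Yang–Mills mass gap (Clay), IRcof, IR, or any leg; the stubs carry
ALL the content; finite-volume / conditional.
-/

set_option autoImplicit false

noncomputable section

open Filter Topology MeasureTheory
open scoped BigOperators
open Literature.MathematicalPhysics.QuantumFieldTheory Literature.MathematicalPhysics.QuantumLattice
open Summit.QuantumFields.YangMills.Cruxes.OSLegsFromFemtoAndGap.DlrCollarTransfer (LowerBounds)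
open Summit.QuantumFields.YangMills.Cruxes.IR.ColdPurityBridge (coldDefect)
open Summit.QuantumFields.YangMills.Cruxes.IR.RankPurity (IRnscCof)
open Summit.QuantumFields.YangMills.Cruxes.IRcof.RunningLandmark (PinnedExitsCofinalAt)
open Summit.QuantumFields.YangMills.Cruxes.IRcof.TemporalTwistSubadditivity (projZ projDefect)

namespace Summit.QuantumFields.YangMills.Cruxes.IRcof.Lines.FluxInterlacing

/-! ## §0 Inlined currency from sheet (lens-2 g1) -/

section Defs

variable {G : Type} [Group G] [TopologicalSpace G] [IsTopologicalGroup G] [CompactSpace G]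
  [MeasurableSpace G] [BorelSpace G]

/-- **Projection datum**: a central `z` of exponent `n ≥ 1` (`z ^ n = 1`). -/
def IsProjDatum (z : G) (n : ℕ) : Prop :=
  z ∈ Subgroup.center G ∧ 0 < n ∧ z ^ n = 1

/-- **Interlacing of the cold box at scale `L`**: charged trace ≤ κ × excited neutral trace proxy. -/
def InterlacedAt {N : ℕ} (ρ : G →* Matrix (Fin N) (Fin N) ℂ) (β : ℝ) (z : G) (n : ℕ) (κ : ℝ) (L : ℕ) : Prop :=
  wilsonFinTorusPartition ρ β L L L (L / 4) ≤
    projZ ρ β z n L (L / 4) + κ * (projZ ρ β z n L (L / 4) - Real.sqrt (projZ ρ β z n L (2 * (L / 4))))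

end Defs

/-- **V — `NeutralPurityCof` (RESIDUAL, declared B2)**: pinned cofinal ε-purity of SOME `⟨z⟩³` e-projection. -/
def NeutralPurityCof : Prop :=
  ∀ (G : Type) [Group G] [TopologicalSpace G] [IsTopologicalGroup G] [CompactSpace G],
    IsCompactSimpleLieGroup G → SimplyConnectedSpace G →
    letI : MeasurableSpace G := borel G
    haveI : BorelSpace G := ⟨rfl⟩
    ∀ (r : LatticeRep G) (a : ℝ → ℝ), (∀ β, 0 < a β) → Tendsto a atTop (𝓝 0) → LowerBounds G r a →
      ∀ ε : ℝ, 0 < ε → ∃ T : ℝ, ∀ β₁ : ℝ, ∃ β : ℝ, β₁ ≤ β ∧ ∃ L : ℕ, 8 ≤ L ∧ a β * (L : ℝ) ≤ T ∧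
        ∃ (z : G) (n : ℕ), IsProjDatum z n ∧ projDefect r.ρ β z n L (L / 4) ≤ ε

/-- **I — `FluxInterlacingEv` (LEVER; skew to PXcof; IDEA-NEEDED)**: neutral purity ⇒ interlacing. -/
def FluxInterlacingEv : Prop :=
  ∀ (G : Type) [Group G] [TopologicalSpace G] [IsTopologicalGroup G] [CompactSpace G],
    IsCompactSimpleLieGroup G → SimplyConnectedSpace G →
    letI : MeasurableSpace G := borel G
    haveI : BorelSpace G := ⟨rfl⟩
    ∀ r : LatticeRep G, ∃ κ ε₀ β₀ : ℝ, 0 ≤ κ ∧ 0 < ε₀ ∧ ∀ β : ℝ, β₀ ≤ β → ∀ L : ℕ, 8 ≤ L →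
      ∀ (z : G) (n : ℕ), IsProjDatum z n → projDefect r.ρ β z n L (L / 4) ≤ ε₀ → InterlacedAt r.ρ β z n κ L

/-! ## §1 Stubs (sorries ONLY here) -/

/-- **stub V — `NeutralPurityCof` (RESIDUAL, declared B2)** -/
theorem stub_neutralPurityCof : NeutralPurityCof := by sorry

/-- **stub I — `FluxInterlacingEv` (LEVER, skew, IDEA-NEEDED)** — hypothesis-shaped named stub. -/
theorem stub_fluxInterlacingEv : FluxInterlacingEv := by sorry

/-- **stub N — `IRnscCof` (SHARED from line of record `pinned_cofinal_bill`)** -/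
theorem stub_irnscCof : IRnscCof := by sorry

/-! ## §2 Real-number conversion -/

/-- **Real-number core.** -/
theorem defect_le_of_proj_interlaced {Z₁ Z₂ A₁ A₂ κ ε : ℝ} (hA₁ : 0 < A₁) (hZ₁ : 0 < Z₁) (hκ : 0 ≤ κ)
    (hε0 : 0 ≤ ε) (hε1 : ε ≤ 1) (hdom : A₂ ≤ Z₂) (hV : 1 - A₂ / A₁ ^ 2 ≤ ε)
    (hI : Z₁ ≤ A₁ + κ * (A₁ - Real.sqrt A₂)) :
    1 - Z₂ / Z₁ ^ 2 ≤ (1 + 2 * κ) * ε := by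
  have hA₁sq : 0 < A₁ ^ 2 := by positivity
  have hA₂ : (1 - ε) * A₁ ^ 2 ≤ A₂ := by
    have h1 : 1 - ε ≤ A₂ / A₁ ^ 2 := by linarith
    exact (le_div_iff₀ hA₁sq).1 h1
  have hA₂nn : 0 ≤ A₂ := le_trans (by nlinarith) hA₂
  have hsq : (1 - ε) * A₁ ≤ Real.sqrt A₂ := by
    have hx : 0 ≤ (1 - ε) * A₁ := mul_nonneg (by linarith) hA₁.le
    have hx2 : ((1 - ε) * A₁) ^ 2 ≤ A₂ := by
      have heq : ((1 - ε) * A₁) ^ 2 = (1 - ε) * ((1 - ε) * A₁ ^ 2) := by ring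
      rw [heq]
      calc (1 - ε) * ((1 - ε) * A₁ ^ 2) ≤ 1 * ((1 - ε) * A₁ ^ 2) :=
             mul_le_mul_of_nonneg_right (by linarith) (by nlinarith)
        _ = (1 - ε) * A₁ ^ 2 := one_mul _
        _ ≤ A₂ := hA₂
    calc (1 - ε) * A₁ = Real.sqrt (((1 - ε) * A₁) ^ 2) := (Real.sqrt_sq hx).symm
      _ ≤ Real.sqrt A₂ := Real.sqrt_le_sqrt hx2
  have hZ₁le : Z₁ ≤ (1 + κ * ε) * A₁ := by
    have h1 : A₁ - Real.sqrt A₂ ≤ ε * A₁ := by linarith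
    have h2 : κ * (A₁ - Real.sqrt A₂) ≤ κ * (ε * A₁) := mul_le_mul_of_nonneg_left h1 hκ
    nlinarith
  have hZ₁sq : Z₁ ^ 2 ≤ (1 + κ * ε) ^ 2 * A₁ ^ 2 := by rw [← mul_pow]; exact pow_le_pow_left₀ hZ₁.le hZ₁le 2
  have hu : 0 ≤ κ * ε := mul_nonneg hκ hε0
  have key : (1 - (1 + 2 * κ) * ε) * (1 + κ * ε) ^ 2 ≤ 1 - ε := by
    nlinarith [mul_nonneg hu hε0, mul_nonneg (mul_nonneg hu hu) hε0, mul_nonneg hu hu, mul_nonneg (mul_nonneg hu hu) hu]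
  have hZ₂ : (1 - (1 + 2 * κ) * ε) * Z₁ ^ 2 ≤ Z₂ := by
    by_cases hs : 0 ≤ 1 - (1 + 2 * κ) * ε
    · calc (1 - (1 + 2 * κ) * ε) * Z₁ ^ 2 ≤ (1 - (1 + 2 * κ) * ε) * ((1 + κ * ε) ^ 2 * A₁ ^ 2) :=
             mul_le_mul_of_nonneg_left hZ₁sq hs
        _ = ((1 - (1 + 2 * κ) * ε) * (1 + κ * ε) ^ 2) * A₁ ^ 2 := by ring
        _ ≤ (1 - ε) * A₁ ^ 2 := mul_le_mul_of_nonneg_right key hA₁sq.le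
        _ ≤ Z₂ := hA₂.trans hdom
    · have h1 : (1 - (1 + 2 * κ) * ε) * Z₁ ^ 2 ≤ 0 := mul_nonpos_of_nonpos_of_nonneg (le_of_lt (not_le.1 hs)) (sq_nonneg _)
      linarith [hA₂nn.trans hdom]
  have hZ₁sq0 : 0 < Z₁ ^ 2 := by positivity
  have h3 : 1 - (1 + 2 * κ) * ε ≤ Z₂ / Z₁ ^ 2 := (le_div_iff₀ hZ₁sq0).2 hZ₂
  linarith

/-! ## §3 Composition: V ∧ I ⇒ PXcof(1/24) ⇒ IRcof BY NAME -/

section Composition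

variable {G : Type} [Group G] [TopologicalSpace G] [IsTopologicalGroup G] [CompactSpace G]
  [MeasurableSpace G] [BorelSpace G] [SecondCountableTopology G] {N : ℕ} {ρ : G →* Matrix (Fin N) (Fin N) ℂ}

theorem projZ_pos (hρ : Continuous ρ) (β : ℝ) (z : G) {n : ℕ} (hn : 0 < n) (L t : ℕ) : 0 < projZ ρ β z n L t := by
  unfold projZ; haveI : NeZero n := ⟨Nat.pos_iff_ne_zero.1 hn⟩; haveI : Nonempty (Fin 3 → Fin n) := ⟨fun _ => 0⟩
  refine mul_pos (inv_pos.2 ?_) (Finset.sum_pos (fun k _ => wilsonFinTorusTensorTwistedPartition_pos ρ hρ β _ _ _ _ _) Finset.univ_nonempty)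
  exact_mod_cast Fintype.card_pos

theorem projZ_le_partition (hρ : Continuous ρ) (hρu : ∀ g, ρ g ∈ Matrix.unitaryGroup (Fin N) ℂ) {β : ℝ} (hβ : 0 ≤ β)
    {z : G} (hz : z ∈ Subgroup.center G) {n : ℕ} (hn : 0 < n) {L t : ℕ} (hL : 2 ≤ L) (ht : 2 ≤ t) :
    projZ ρ β z n L t ≤ wilsonFinTorusPartition ρ β L L L t := by
  unfold projZ; haveI : NeZero n := ⟨Nat.pos_iff_ne_zero.1 hn⟩
  have hcard : (0 : ℝ) < ((Fintype.card (Fin 3 → Fin n) : ℕ) : ℝ) := by haveI : Nonempty (Fin 3 → Fin n) := ⟨fun _ => 0⟩; exact_mod_cast Fintype.card_pos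
  have hle : ∑ k : Fin 3 → Fin n, wilsonFinTorusTensorTwistedPartition ρ β (TemporalTwistSubadditivity.eTwist z k) L L L t ≤
      ∑ _k : Fin 3 → Fin n, wilsonFinTorusPartition ρ β L L L t :=
    Finset.sum_le_sum fun k _ => wilsonFinTorusTensorTwistedPartition_le_partition ρ hρ hρu hβ
      (fun μ ν _ => TemporalTwistSubadditivity.eTwist_center hz k μ ν) hL hL ht
  rw [Finset.sum_const, Finset.card_univ, nsmul_eq_mul] at hle
  calc ((Fintype.card (Fin 3 → Fin n) : ℕ) : ℝ)⁻¹ * ∑ k : Fin 3 → Fin n,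
          wilsonFinTorusTensorTwistedPartition ρ β (TemporalTwistSubadditivity.eTwist z k) L L L t
        ≤ ((Fintype.card (Fin 3 → Fin n) : ℕ) : ℝ)⁻¹ * (((Fintype.card (Fin 3 → Fin n) : ℕ) : ℝ) * wilsonFinTorusPartition ρ β L L L t) :=
        mul_le_mul_of_nonneg_left hle (inv_nonneg.2 hcard.le)
    _ = wilsonFinTorusPartition ρ β L L L t := by rw [← mul_assoc, inv_mul_cancel₀ hcard.ne', one_mul]

theorem coldDefect_le_of_projPure_interlaced (hρ : Continuous ρ) (hρu : ∀ g, ρ g ∈ Matrix.unitaryGroup (Fin N) ℂ)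
    {β : ℝ} (hβ : 0 ≤ β) {L : ℕ} (hL : 8 ≤ L) {z : G} {n : ℕ} (hzn : IsProjDatum z n)
    {κ ε : ℝ} (hκ : 0 ≤ κ) (hε0 : 0 ≤ ε) (hε1 : ε ≤ 1)
    (hV : projDefect ρ β z n L (L / 4) ≤ ε) (hI : InterlacedAt ρ β z n κ L) :
    coldDefect ρ β L ≤ (1 + 2 * κ) * ε := by
  have hL2 : 2 ≤ L := by omega
  have ht2 : 2 ≤ 2 * (L / 4) := by omega
  unfold coldDefect; unfold projDefect at hV; unfold InterlacedAt at hI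
  exact defect_le_of_proj_interlaced (projZ_pos hρ β z hzn.2.1 L (L / 4)) (wilsonFinTorusPartition_pos hρ β L L L (L / 4))
    hκ hε0 hε1 (projZ_le_partition hρ hρu hβ hzn.1 hzn.2.1 hL2 ht2) hV hI

end Composition

/-- ★★ **V ∧ I ⇒ PXcof(1∕24)** (`PinnedExitsCofinalAt (1/24)`) — the supplier arrow. -/
theorem pinnedExitsCofinal_of_neutral_interlacing (hV : NeutralPurityCof) (hI : FluxInterlacingEv) :
    PinnedExitsCofinalAt (1 / 24) := by
  intro G _ _ _ _ hG hsc; letI : MeasurableSpace G := borel G; haveI : BorelSpace G := ⟨rfl⟩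
  intro r a ha ha0 hlb
  obtain ⟨κ, ε₀, β₀, hκ, hε₀, hIr⟩ := hI G hG hsc r
  have h24 : (0 : ℝ) < 24 * (1 + 2 * κ) := by positivity
  set ε : ℝ := min ε₀ (1 / (24 * (1 + 2 * κ))) with hεdef
  have hεpos : 0 < ε := lt_min hε₀ (by positivity)
  have hεle₀ : ε ≤ ε₀ := min_le_left _ _
  have hεle : ε ≤ 1 / (24 * (1 + 2 * κ)) := min_le_right _ _
  have hε1 : ε ≤ 1 := by refine hεle.trans ?_; rw [div_le_iff₀ h24]; nlinarith
  obtain ⟨T, hT⟩ := hV G hG hsc r a ha ha0 hlb ε hεpos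
  refine ⟨T, fun β₁ => ?_⟩
  obtain ⟨β, hβ, L, hL, haL, z, n, hzn, hproj⟩ := hT (max β₁ (max β₀ 0))
  have hβ₁ : β₁ ≤ β := le_trans (le_max_left _ _) hβ
  have hβ₀ : β₀ ≤ β := le_trans ((le_max_left _ _).trans (le_max_right _ _)) hβ
  have hβ0 : 0 ≤ β := le_trans ((le_max_right _ _).trans (le_max_right _ _)) hβ
  haveI : SecondCountableTopology G := (r.continuous.isClosedEmbedding r.injective).isEmbedding.secondCountableTopology
  have hint : InterlacedAt r.ρ β z n κ L := hIr β hβ₀ L hL z n hzn (hproj.trans hεle₀)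
  have hcd := coldDefect_le_of_projPure_interlaced r.continuous r.mem_unitary hβ0 hL hzn hκ hεpos.le hε1 hproj hint
  refine ⟨β, hβ₁, L, hL, haL, ?_⟩; show coldDefect r.ρ β L ≤ 1 / 24
  refine hcd.trans ?_
  calc (1 + 2 * κ) * ε ≤ (1 + 2 * κ) * (1 / (24 * (1 + 2 * κ))) := mul_le_mul_of_nonneg_left hεle (by positivity)
    _ = 1 / 24 := by
      have h12 : (1 + 2 * κ) ≠ 0 := by positivity
      have h24' : (24 : ℝ) ≠ 0 := by norm_num
      field_simp [h12, h24']

/-- **V ∧ I ⇒ PXcof(1/24) from stubs** — SUPPLIER ARROW #2. Any proof of V and I closes `stub_pinnedExitsCofinal`. -/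
theorem pinnedExitsCofinal_of_stubs : PinnedExitsCofinalAt (1 / 24) :=
  pinnedExitsCofinal_of_neutral_interlacing stub_neutralPurityCof stub_fluxInterlacingEv

/-- **IRcof from all three stubs** — concluding theorem V ∧ I ∧ N ⇒ IRcof BY NAME. -/
theorem IRcof_of : Summit.QuantumFields.YangMills.Theses.BalabanLadder.IRcof :=
  Summit.QuantumFields.YangMills.Cruxes.IR.LevelwiseDomination.IRcof_of_pinnedExitsCofinalAt
    (pinnedExitsCofinal_of_neutral_interlacing stub_neutralPurityCof stub_fluxInterlacingEv) stub_irnscCof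

end Summit.QuantumFields.YangMills.Cruxes.IRcof.Lines.FluxInterlacing

end
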